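import Mathlib
import HarnessLib
import Literature.Analysis.FluidPDE.TypeIAncientMild
import Literature.Analysis.FluidPDE.LocalTypeIReverseTools
import Literature.Analysis.FluidPDE.LocalPressureOscillation
import Literature.Analysis.FluidPDE.ClassicalSuitable
import Literature.Analysis.FluidPDE.ClassicalSolutionGlue
import Literature.Analysis.FluidPDE.SuitableWeakInBallTools
import Literature.Analysis.FluidPDE.SuitableWeakPressure
import Literature.Analysis.FluidPDE.LocalEnergyTimeShift
import Summits.NavierStokesRegularity.NavierStokesRegularity.Theorems.SymmetryModuliCountAxisymEndLiouvilleOfFarPastLedgerPressureSlice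

/-!
# `AxisymEndLiouvilleOfFarPastLedger` (stmt-NavierStokesRegularity-14736), 𝒦-route:
# the pressure package, II: the shifted pair in Albritton–Barker's class and the uniform bound

Route SymmetryModuliCount. The blow-down driver of the item
(`Theorems/SymmetryModuliCountAxisymEndLiouvilleOfFarPastLedgerDriver.lean`,
`exists_singular_axisymmetric_limit`) consumes a PRESSURE PACKAGE for the Type-I ancient mild class
`A_C` under the far-past ledger: every backward shift `w(· − T)`, `0 < T ≤ 1`, of a `w ∈ A_C` with
ledger constant `K` has a pressure `q` making it a suitable weak solution in the unit parabolic
ball `Q(0, 1)` in Albritton–Barker's class (Def. 2.1), with the UNIFORM bound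
`∫_{Q(0,1)} |q|^{3/2} ≤ D₀(C, K)` — the `D`-half of "`A_C ⊂ 𝒦` given the ledger" (item text:
"pressure/dissipation parts from the local energy inequality + Calderón–Zygmund for the Oseen
pressure").

This file derives the package (`pressurePackage_of_nearFar`) from the NEAR/FAR STRUCTURE of the
classical window pressure of the class — the statement proved for `A_C` by the sibling crux
`FarPastLedger` (Cruxes/FarPastLedger/Lines/uloc_gronwall_transplant.lean, `nearFar_window`:
KNSS smoothing for `∇p`, slice harmonic analysis, pinning of the affine mode by the Oseen identity),
taken here as the hypothesis `hNF`: on the window `(−3, 0)` the classical pressure `p` of `w`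
splits on the ball `B₂(0)` at every time `τ` as `p(τ) = c + p₁ + p₂` with
`‖p₁‖₂² ≤ c₀ (C²/(−τ)) ∫_{B₄(0)} ‖w(τ)‖²` and `‖∇p₂‖ ≤ c₀ ∫_{|y| ≥ 3} ‖w(τ,y)‖² |y|⁻⁴` on `B₂(0)`.

The estimate (slice by slice, then in time):
* near part (Hölder `3/2 = 2·(3/4)`): `∫_{B₁} |p₁|^{3/2} ≤ (∫ p₁²)^{3/4} |B₁|^{1/4} ≤ (4c₀C²K)^{3/4} |B₁|^{1/4} (−τ)^{-3/4}` by the ledger at radius `4`;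
* far part (mean value): `|p₂(x) − p₂(0)| ≤ sup_{B₂}‖∇p₂‖ ≤ c₀ · cS · K` by the far-shell sum of the
  unit-ball ledger (`stub_fplFarShell`, `stub_fplCovering`, landed for the crux `FarPastLedger`);
* the ball mean costs a factor `4` (`setLIntegral_rpow_sub_average_le_of_const`, RRS Ex. 15.2);
* `∫_{-1}^{0} (−τ)^{-3/4} dτ = 4`, so `∫_{Q((−T,0),1)} |p − [p]_{B₁}|^{3/2} ≤ D₀`;
* the shifted classical pair is suitable on a slab around `[−1, 0]` (CKN: classical solutions
  are suitable, `isSuitableWeakSolutionOn_of_contDiffOn`), stays suitable after subtracting the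
  continuous ball mean (`IsSuitableWeakSolutionOn.sub_pressure`), and is then in Albritton–Barker's
  class on `Q(0,1)` (`IsSuitableWeakSolutionOn.isSuitableWeakSolutionInBall`).

## References

* D. Albritton, T. Barker, J. Math. Fluid Mech. 21 (2019), Def. 2.1, §3. [AlbrittonBarker2019]
* G. Koch, N. Nadirashvili, G. Seregin, V. Šverák, Acta Math. 203 (2009), §3–4 (the Oseen
  pressure of bounded mild solutions). [KochNadirashviliSereginSverak2009]
* J. C. Robinson, J. L. Rodrigo, W. Sadowski, *The three-dimensional Navier–Stokes equations*
  (2016), Lemma 15.12, Exercise 15.2. [RobinsonRodrigoSadowski2016]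
-/

noncomputable section

-- the summit and its single problem share the name (D-0017 nested layout)
set_option linter.dupNamespace false

open MeasureTheory Set Metric Filter Function TopologicalSpace
open scoped ENNReal NNReal Topology

namespace Summit.NavierStokesRegularity.NavierStokesRegularity.Theorems.AxisymEndLiouvilleOfFarPastLedger

open Literature.Analysis.FluidPDE
open Summit.NavierStokesRegularity.NavierStokesRegularity.Theorems

/-! ### The shifted classical pair in Albritton–Barker's class on `Q(0, 1)` -/

/-- **The backward shift of a classical window pair, its pressure normalised by the unit-ball
mean, is a suitable weak solution in `Q(0,1)` in Albritton–Barker's class.** For a classical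
solution `(w, p)` on the window `(−3, 0)` and `0 < T ≤ 1`, the pair
`(w(· − T), p(· − T) − [p(· − T)]_{B₁(0)})` is classical on `(−3+T, T) ⊃ [−1, 0]`, hence suitable on
the slab `(−3/2, T/2) × ℝ³` (CKN: `isSuitableWeakSolutionOn_of_contDiffOn`), still suitable after
subtracting the CONTINUOUS ball mean (`IsSuitableWeakSolutionOn.sub_pressure`), and therefore in
the class on the unit parabolic ball, whose closed box lies in that slab
(`IsSuitableWeakSolutionOn.isSuitableWeakSolutionInBall`). [cite: AlbrittonBarker2019, Def. 2.1] -/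
theorem inBall_shift_subMean {w : ℝ → EuclideanSpace ℝ (Fin 3) → EuclideanSpace ℝ (Fin 3)}
    {p : ℝ → EuclideanSpace ℝ (Fin 3) → ℝ} {T : ℝ} (hT0 : 0 < T) (hT1 : T ≤ 1)
    (hcl : IsClassicalNSSolutionOn (Ioo (-3) 0) 1 0 w p) :
    IsSuitableWeakSolutionInBall 1 0 (fun s y => w (s - T) y)
      (fun s y => p (s - T) y - ⨍ y' in ball (0 : EuclideanSpace ℝ (Fin 3)) 1, p (s - T) y') := by
  -- ### the shifted classical pair on `(-3 + T, T)`
  have hpre : (fun t : ℝ => t + -T) ⁻¹' Ioo (-3 : ℝ) 0 = Ioo (-3 + T) T := by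
    ext t
    simp only [mem_preimage, mem_Ioo]
    constructor <;> intro h <;> constructor <;> linarith [h.1, h.2]
  have hclS : IsClassicalNSSolutionOn (Ioo (-3 + T) T) 1 0 (fun t => w (t - T)) (fun t => p (t - T)) := by
    have h := hcl.comp_add_right (-T)
    have h0 : (fun t => (0 : ℝ → EuclideanSpace ℝ (Fin 3) → EuclideanSpace ℝ (Fin 3)) (t + -T)) = 0 := by
      funext t; rfl
    rw [hpre, h0] at h
    simpa only [← sub_eq_add_neg] using h
  set W : ℝ → EuclideanSpace ℝ (Fin 3) → EuclideanSpace ℝ (Fin 3) := fun s y => w (s - T) y with hW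
  set P : ℝ → EuclideanSpace ℝ (Fin 3) → ℝ := fun s y => p (s - T) y with hP
  -- ### suitability on the slab `S₃ = (-3/2, T/2)`
  set S₃ : Set ℝ := Ioo (-3 / 2 : ℝ) (T / 2) with hS₃
  have hS₃sub : S₃ ⊆ Ioo (-3 + T) T := Ioo_subset_Ioo (by linarith) (by linarith)
  have hQ : ((slab (EuclideanSpace ℝ (Fin 3)) S₃ isOpen_Ioo : Opens (ℝ × EuclideanSpace ℝ (Fin 3))) :
      Set (ℝ × EuclideanSpace ℝ (Fin 3))) ⊆ Ioo (-3 + T) T ×ˢ univ :=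
    fun z hz => ⟨hS₃sub (mem_slab.1 hz), mem_univ _⟩
  have hsw : IsSuitableWeakSolutionOn (slab (EuclideanSpace ℝ (Fin 3)) S₃ isOpen_Ioo) 1 0 W P := by
    refine isSuitableWeakSolutionOn_of_contDiffOn isOpen_Ioo hQ
      (hclS.smooth_velocity.of_le (by norm_cast)) (hclS.smooth_pressure.of_le (by norm_cast))
      continuousOn_const (fun t ht x => ?_) hclS.divFree
    have hm := hclS.momentum t ht x
    rwa [timeDerivWithin_apply, derivWithin_of_isOpen isOpen_Ioo ht, ← timeDeriv_apply] at hm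
  -- ### the unit-ball mean of the shifted pressure is continuous on `Icc (-3/2) (T/2)`
  set m : ℝ → ℝ := fun s => ⨍ y' in ball (0 : EuclideanSpace ℝ (Fin 3)) 1, P s y' with hm_def
  have hK : IsCompact (Icc (-3 / 2 : ℝ) (T / 2) ×ˢ closedBall (0 : EuclideanSpace ℝ (Fin 3)) 1) :=
    isCompact_Icc.prod (isCompact_closedBall 0 1)
  have hKsub : Icc (-3 / 2 : ℝ) (T / 2) ×ˢ closedBall (0 : EuclideanSpace ℝ (Fin 3)) 1 ⊆ Ioo (-3 + T) T ×ˢ univ :=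
    prod_mono (Icc_subset_Ioo (by linarith) (by linarith)) (subset_univ _)
  have hPc : ContinuousOn (uncurry P) (Ioo (-3 + T) T ×ˢ univ) := hclS.smooth_pressure.continuousOn
  obtain ⟨M, hM⟩ := hK.exists_bound_of_continuousOn (hPc.mono hKsub)
  have hmc : ContinuousOn m (Icc (-3 / 2 : ℝ) (T / 2)) := by
    have hint : ContinuousOn (fun s => ∫ y' in ball (0 : EuclideanSpace ℝ (Fin 3)) 1, P s y')
        (Icc (-3 / 2 : ℝ) (T / 2)) := by
      refine continuousOn_of_dominated (bound := fun _ => M) ?_ ?_ ?_ ?_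
      · intro s hs
        have hsS : s ∈ Ioo (-3 + T) T := ⟨by linarith [hs.1], by linarith [hs.2]⟩
        exact (hclS.contDiff_pressure hsS).continuous.aestronglyMeasurable
      · intro s hs
        filter_upwards [ae_restrict_mem measurableSet_ball] with y hy
        exact hM (s, y) ⟨hs, ball_subset_closedBall hy⟩
      · exact integrableOn_const measure_ball_lt_top.ne
      · filter_upwards [ae_restrict_mem measurableSet_ball] with y _
        have hc2 : Continuous fun s : ℝ => ((s, y) : ℝ × EuclideanSpace ℝ (Fin 3)) := by fun_prop
        exact hPc.comp hc2.continuousOn fun s hs => ⟨⟨by linarith [hs.1], by linarith [hs.2]⟩, mem_univ _⟩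
    have e : m = fun s => (volume.real (ball (0 : EuclideanSpace ℝ (Fin 3)) 1))⁻¹ •
        ∫ y' in ball (0 : EuclideanSpace ℝ (Fin 3)) 1, P s y' := by
      funext s
      simp only [hm_def, setAverage_eq]
    rw [e]
    exact hint.const_smul ((volume.real (ball (0 : EuclideanSpace ℝ (Fin 3)) 1))⁻¹)
  -- ### subtracting the mean keeps suitability on the slab
  have hmslab : ContinuousOn (fun z : ℝ × EuclideanSpace ℝ (Fin 3) => m z.1)
      ((slab (EuclideanSpace ℝ (Fin 3)) S₃ isOpen_Ioo : Opens (ℝ × EuclideanSpace ℝ (Fin 3))) :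
        Set (ℝ × EuclideanSpace ℝ (Fin 3))) :=
    hmc.comp continuousOn_fst fun z hz => Ioo_subset_Icc_self (mem_slab.1 hz)
  have hsw' : IsSuitableWeakSolutionOn (slab (EuclideanSpace ℝ (Fin 3)) S₃ isOpen_Ioo) 1 0 W
      (fun s y => P s y - m s) := by
    refine hsw.sub_pressure (c := m) ?_ ?_
    · exact hmslab.locallyIntegrableOn (Opens.isOpen _).measurableSet
    · intro K hK' hKc
      obtain ⟨B, hB⟩ := hKc.exists_bound_of_continuousOn (hmslab.mono hK')
      calc ∫⁻ z in K, ‖m z.1‖ₑ ^ (3 / 2 : ℝ) ≤ ∫⁻ _ in K, ENNReal.ofReal B ^ (3 / 2 : ℝ) := by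
            refine setLIntegral_mono measurable_const fun z hz => ?_
            refine ENNReal.rpow_le_rpow ?_ (by norm_num)
            rw [← ofReal_norm]
            exact ENNReal.ofReal_le_ofReal (hB z hz)
        _ < ⊤ := by
            rw [setLIntegral_const]
            exact ENNReal.mul_lt_top (ENNReal.rpow_lt_top_of_nonneg (by norm_num) ENNReal.ofReal_ne_top)
              hKc.measure_lt_top
  -- ### the closed unit box lies in the slab
  have hsub : Icc ((0 : ℝ × EuclideanSpace ℝ (Fin 3)).1 - 1 ^ 2) (0 : ℝ × EuclideanSpace ℝ (Fin 3)).1 ×ˢ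
      closedBall (0 : ℝ × EuclideanSpace ℝ (Fin 3)).2 1 ⊆
      ((slab (EuclideanSpace ℝ (Fin 3)) S₃ isOpen_Ioo : Opens (ℝ × EuclideanSpace ℝ (Fin 3))) :
        Set (ℝ × EuclideanSpace ℝ (Fin 3))) := by
    rintro ⟨s, y⟩ ⟨hs, -⟩
    rw [SetLike.mem_coe, mem_slab]
    simp only [Prod.fst_zero, one_pow, zero_sub, mem_Icc] at hs
    exact ⟨by linarith [hs.1], by linarith [hs.2]⟩
  exact hsw'.isSuitableWeakSolutionInBall hsub

/-! ### The uniform `L^{3/2}` bound of the normalised shifted pressure -/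

/-- The real form of the slice bound of `slice_osc_le` (all quantities finite and nonnegative).
[folklore] -/
theorem slice_bound_eq_ofReal {A L : ℝ} (hA : 0 ≤ A) (hL : 0 ≤ L) :
    4 * (2 ^ (1 / 2 : ℝ) * (ENNReal.ofReal A ^ (3 / 4 : ℝ) *
          volume (ball (0 : EuclideanSpace ℝ (Fin 3)) 1) ^ (1 / 4 : ℝ) +
        ENNReal.ofReal L ^ (3 / 2 : ℝ) * volume (ball (0 : EuclideanSpace ℝ (Fin 3)) 1))) =
      ENNReal.ofReal (4 * ((2 : ℝ) ^ (1 / 2 : ℝ) * (A ^ (3 / 4 : ℝ) *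
          (volume (ball (0 : EuclideanSpace ℝ (Fin 3)) 1)).toReal ^ (1 / 4 : ℝ) +
        L ^ (3 / 2 : ℝ) * (volume (ball (0 : EuclideanSpace ℝ (Fin 3)) 1)).toReal))) := by
  set V : ℝ≥0∞ := volume (ball (0 : EuclideanSpace ℝ (Fin 3)) 1) with hV
  have hVtop : V ≠ ⊤ := measure_ball_lt_top.ne
  have hVr : V = ENNReal.ofReal V.toReal := (ENNReal.ofReal_toReal hVtop).symm
  have hV0 : 0 ≤ V.toReal := ENNReal.toReal_nonneg
  have h2 : (2 : ℝ≥0∞) ^ (1 / 2 : ℝ) = ENNReal.ofReal ((2 : ℝ) ^ (1 / 2 : ℝ)) := by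
    rw [← ENNReal.ofReal_ofNat 2, ENNReal.ofReal_rpow_of_pos (by norm_num)]
  conv_lhs => rw [hVr]
  rw [h2, ENNReal.ofReal_rpow_of_nonneg hA (by norm_num), ENNReal.ofReal_rpow_of_nonneg hV0 (by norm_num),
    ENNReal.ofReal_rpow_of_nonneg hL (by norm_num), ← ENNReal.ofReal_mul (Real.rpow_nonneg hA _),
    ← ENNReal.ofReal_mul (Real.rpow_nonneg hL _), ← ENNReal.ofReal_add (by positivity) (by positivity),
    ← ENNReal.ofReal_mul (Real.rpow_nonneg (by norm_num) _), ← ENNReal.ofReal_ofNat 4,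
    ← ENNReal.ofReal_mul (by norm_num)]

/-- **The uniform `D`-bound of the normalised shifted pressure.** For `w ∈ A_C` with the ledger
constant `K ≥ 0`, a classical pressure `p` of `w` on the window `(−3, 0)` with the near/far
structure at the centre `0` (constant `c₀ ≥ 0`, far gradients bounded by `L₀ ≥ 0`), and
`0 < T ≤ 1`: `∫_{Q(0,1)} |p(s−T, y) − [p(s−T)]_{B₁}|^{3/2} ≤ D₀` with
`D₀ = 16√2 (4c₀C²K)^{3/4} |B₁|^{1/4} + 4√2 L₀^{3/2} |B₁|` (time shift onto `Q((−T,0),1)`, the slice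
estimate, `∫ (−τ)^{-3/4} ≤ 4`). [cite: AlbrittonBarker2019, §3] -/
theorem shifted_pressure_lintegral_le {C K c₀ L₀ : ℝ} (hc₀ : 0 ≤ c₀) (hK : 0 ≤ K) (hL₀ : 0 ≤ L₀)
    {w : ℝ → EuclideanSpace ℝ (Fin 3) → EuclideanSpace ℝ (Fin 3)}
    (hKw : ∀ t < 0, ∀ (x₀ : EuclideanSpace ℝ (Fin 3)) (R : ℝ), 0 < R →
      ∫ x in ball x₀ R, ‖w t x‖ ^ 2 ≤ K * R)
    {p : ℝ → EuclideanSpace ℝ (Fin 3) → ℝ} (hcl : IsClassicalNSSolutionOn (Ioo (-3) 0) 1 0 w p)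
    (hNF : ∀ τ ∈ Ioo (-3 : ℝ) 0, ∃ (c : ℝ) (p₁ p₂ : EuclideanSpace ℝ (Fin 3) → ℝ),
      (∀ x ∈ ball (0 : EuclideanSpace ℝ (Fin 3)) 2, p τ x = c + p₁ x + p₂ x) ∧ MemLp p₁ 2 volume ∧
      ∫ x, p₁ x ^ 2 ≤ c₀ * (C ^ 2 / (-τ)) * ∫ x in ball (0 : EuclideanSpace ℝ (Fin 3)) 4, ‖w τ x‖ ^ 2 ∧
      ∀ x ∈ ball (0 : EuclideanSpace ℝ (Fin 3)) 2, DifferentiableAt ℝ p₂ x ∧ ‖fderiv ℝ p₂ x‖ ≤ L₀)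
    {T : ℝ} (hT0 : 0 < T) (hT1 : T ≤ 1) :
    ∫⁻ z in parabolicCylinder 1 (0 : ℝ × EuclideanSpace ℝ (Fin 3)),
        ‖p (z.1 - T) z.2 - ⨍ y' in ball (0 : EuclideanSpace ℝ (Fin 3)) 1, p (z.1 - T) y'‖ₑ ^ (3 / 2 : ℝ) ≤
      ENNReal.ofReal (4 * (4 * ((2 : ℝ) ^ (1 / 2 : ℝ) * ((4 * c₀ * C ^ 2 * K) ^ (3 / 4 : ℝ) *
          (volume (ball (0 : EuclideanSpace ℝ (Fin 3)) 1)).toReal ^ (1 / 4 : ℝ)))) +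
        4 * ((2 : ℝ) ^ (1 / 2 : ℝ) * (L₀ ^ (3 / 2 : ℝ) *
          (volume (ball (0 : EuclideanSpace ℝ (Fin 3)) 1)).toReal))) := by
  set V : ℝ := (volume (ball (0 : EuclideanSpace ℝ (Fin 3)) 1)).toReal with hV
  set a : ℝ := 4 * ((2 : ℝ) ^ (1 / 2 : ℝ) * ((4 * c₀ * C ^ 2 * K) ^ (3 / 4 : ℝ) * V ^ (1 / 4 : ℝ))) with ha
  set b : ℝ := 4 * ((2 : ℝ) ^ (1 / 2 : ℝ) * (L₀ ^ (3 / 2 : ℝ) * V)) with hb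
  have hV0 : 0 ≤ V := ENNReal.toReal_nonneg
  have hA0 : 0 ≤ 4 * c₀ * C ^ 2 * K := by positivity
  have ha0 : 0 ≤ a := by positivity
  have hb0 : 0 ≤ b := by positivity
  -- ### time shift onto the ball `Q((-T, 0), 1)`
  set G : ℝ → EuclideanSpace ℝ (Fin 3) → ℝ≥0∞ := fun s y =>
    ‖p s y - ⨍ y' in ball (0 : EuclideanSpace ℝ (Fin 3)) 1, p s y'‖ₑ ^ (3 / 2 : ℝ) with hG
  have hshift : ∫⁻ z in parabolicCylinder 1 (0 : ℝ × EuclideanSpace ℝ (Fin 3)),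
      ‖p (z.1 - T) z.2 - ⨍ y' in ball (0 : EuclideanSpace ℝ (Fin 3)) 1, p (z.1 - T) y'‖ₑ ^ (3 / 2 : ℝ) =
      ∫⁻ z in parabolicCylinder 1 ((-T : ℝ), (0 : EuclideanSpace ℝ (Fin 3))), G z.1 z.2 := by
    have h := setLIntegral_prod_timeShift (-T) (-T - 1) (-T) (ball (0 : EuclideanSpace ℝ (Fin 3)) 1)
      (fun z => G z.1 z.2)
    have e1 : parabolicCylinder 1 (0 : ℝ × EuclideanSpace ℝ (Fin 3)) =
        Ioo (-T - 1 - -T) (-T - -T) ×ˢ ball (0 : EuclideanSpace ℝ (Fin 3)) 1 := by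
      rw [show (-T - 1 - -T : ℝ) = 0 - 1 ^ 2 by ring, show (-T - -T : ℝ) = 0 by ring]; rfl
    have e2 : parabolicCylinder 1 ((-T : ℝ), (0 : EuclideanSpace ℝ (Fin 3))) =
        Ioo (-T - 1) (-T) ×ˢ ball (0 : EuclideanSpace ℝ (Fin 3)) 1 := by
      rw [show (-T - 1 : ℝ) = -T - 1 ^ 2 by ring]; rfl
    rw [e1, e2, ← h]
    refine lintegral_congr fun z => ?_
    simp only [hG, show -T + z.1 = z.1 - T by ring]
  rw [hshift]
  -- ### the slice bound on `Q((-T,0),1)` and the time integration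
  refine lintegral_unitCylinder_le_of_slice (z := ((-T : ℝ), (0 : EuclideanSpace ℝ (Fin 3))))
    (by simpa using hT0.le) ha0 hb0 fun τ hτ => ?_
  simp only at hτ
  have hτ0 : τ < 0 := by linarith [hτ.2]
  have hτ3 : τ ∈ Ioo (-3 : ℝ) 0 := ⟨by linarith [hτ.1], hτ0⟩
  obtain ⟨c, p₁, p₂, hdec, hmem, hnear, hfar⟩ := hNF τ hτ3
  -- the near bound `∫ p₁² ≤ 4 c₀ C² K / (-τ)`
  set A : ℝ := 4 * c₀ * C ^ 2 * K / (-τ) with hAdef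
  have hnτ : 0 < -τ := by linarith
  have hA : 0 ≤ A := div_nonneg hA0 hnτ.le
  have hle : ∫ x, p₁ x ^ 2 ≤ A := by
    refine hnear.trans ?_
    have h4 := hKw τ hτ0 (0 : EuclideanSpace ℝ (Fin 3)) 4 (by norm_num)
    calc c₀ * (C ^ 2 / (-τ)) * ∫ x in ball (0 : EuclideanSpace ℝ (Fin 3)) 4, ‖w τ x‖ ^ 2
        ≤ c₀ * (C ^ 2 / (-τ)) * (K * 4) :=
          mul_le_mul_of_nonneg_left h4 (mul_nonneg hc₀ (div_nonneg (sq_nonneg C) hnτ.le))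
      _ = A := by rw [hAdef]; field_simp
  have hpint : IntegrableOn (p τ) (ball (0 : EuclideanSpace ℝ (Fin 3)) 1) volume :=
    ((hcl.contDiff_pressure hτ3).continuous.continuousOn.integrableOn_compact
      (isCompact_closedBall (0 : EuclideanSpace ℝ (Fin 3)) 1)).mono_set ball_subset_closedBall
  have hslice := slice_osc_le hpint hdec hmem hle (fun x hx => (hfar x hx).1) (fun x hx => (hfar x hx).2)
  refine hslice.trans ?_
  rw [slice_bound_eq_ofReal hA hL₀]
  refine ENNReal.ofReal_le_ofReal (le_of_eq ?_)
  -- `A^{3/4} = (4 c₀ C² K)^{3/4} (-τ)^{-3/4}`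
  have hApow : A ^ (3 / 4 : ℝ) = (4 * c₀ * C ^ 2 * K) ^ (3 / 4 : ℝ) * (-τ) ^ (-(3 / 4) : ℝ) := by
    rw [hAdef, Real.div_rpow hA0 hnτ.le, Real.rpow_neg hnτ.le, div_eq_mul_inv]
  show 4 * ((2 : ℝ) ^ (1 / 2 : ℝ) * (A ^ (3 / 4 : ℝ) * V ^ (1 / 4 : ℝ) + L₀ ^ (3 / 2 : ℝ) * V)) =
    a * (-τ) ^ (-(3 / 4) : ℝ) + b
  rw [hApow, ha, hb]
  ring

/-! ### The pressure package -/

/-- **The pressure package of the 𝒦-route from the near/far structure of the window pressure.**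
Assume the far-shell sum of the unit-ball energies (constant `cS`, the landed `stub_fplFarShell`
fed with `stub_fplCovering`) and, for every `w ∈ A_C`, a classical pressure on the window `(−3,0)`
with the near/far structure at the centre `0` (constant `c₀`; the sibling crux `FarPastLedger`'s
`nearFar_window`). Then there is `D₀ = D₀(C, K, c₀, cS)` such that every backward shift
`w(· − T)`, `0 < T ≤ 1`, of a `w ∈ A_C` with ledger `K` has a pressure `q` with
`IsSuitableWeakSolutionInBall 1 0 (w(· − T)) q` and `∫_{Q(0,1)} |q|^{3/2} ≤ D₀` — exactly the
hypothesis `hPress` of the driver `exists_singular_axisymmetric_limit`.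
[cite: AlbrittonBarker2019, Def. 2.1 and §3] -/
theorem pressurePackage_of_nearFar {C K c₀ cS : ℝ} (hc₀ : 0 ≤ c₀) (hcS : 0 ≤ cS)
    (hShell : ∀ g : EuclideanSpace ℝ (Fin 3) → ℝ, Continuous g → (∀ x, 0 ≤ g x) → (∃ M : ℝ, ∀ x, g x ≤ M) →
      ∀ (B : ℝ) (x₁ : EuclideanSpace ℝ (Fin 3)),
      (∀ z : EuclideanSpace ℝ (Fin 3), ∫ x in ball z 1, g x ≤ B) →
        IntegrableOn (fun y => g y / ‖y - x₁‖ ^ 4) (ball x₁ 3)ᶜ volume ∧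
          ∫ y in (ball x₁ 3)ᶜ, g y / ‖y - x₁‖ ^ 4 ≤ cS * B)
    (hNF : ∀ w : ℝ → EuclideanSpace ℝ (Fin 3) → EuclideanSpace ℝ (Fin 3), IsTypeIAncientMild C w →
      ∃ p : ℝ → EuclideanSpace ℝ (Fin 3) → ℝ, IsClassicalNSSolutionOn (Ioo (-3) 0) 1 0 w p ∧
        ∀ τ ∈ Ioo (-3 : ℝ) 0, ∃ (c : ℝ) (p₁ p₂ : EuclideanSpace ℝ (Fin 3) → ℝ),
          (∀ x ∈ ball (0 : EuclideanSpace ℝ (Fin 3)) 2, p τ x = c + p₁ x + p₂ x) ∧ MemLp p₁ 2 volume ∧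
          ∫ x, p₁ x ^ 2 ≤ c₀ * (C ^ 2 / (-τ)) * ∫ x in ball (0 : EuclideanSpace ℝ (Fin 3)) 4, ‖w τ x‖ ^ 2 ∧
          ∀ x ∈ ball (0 : EuclideanSpace ℝ (Fin 3)) 2, DifferentiableAt ℝ p₂ x ∧
            ‖fderiv ℝ p₂ x‖ ≤ c₀ * ∫ y in (ball (0 : EuclideanSpace ℝ (Fin 3)) 3)ᶜ,
              ‖w τ y‖ ^ 2 / ‖y - (0 : EuclideanSpace ℝ (Fin 3))‖ ^ 4) :
    ∃ D₀ : ℝ, ∀ w : ℝ → EuclideanSpace ℝ (Fin 3) → EuclideanSpace ℝ (Fin 3), IsTypeIAncientMild C w →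
      (∀ t < 0, ∀ (x₀ : EuclideanSpace ℝ (Fin 3)) (R : ℝ), 0 < R →
        ∫ x in ball x₀ R, ‖w t x‖ ^ 2 ≤ K * R) →
      ∀ T ∈ Ioc (0 : ℝ) 1, ∃ q : ℝ → EuclideanSpace ℝ (Fin 3) → ℝ,
        IsSuitableWeakSolutionInBall 1 0 (fun s y => w (s - T) y) q ∧
        ∫⁻ z in parabolicCylinder 1 (0 : ℝ × EuclideanSpace ℝ (Fin 3)), ‖q z.1 z.2‖ₑ ^ (3 / 2 : ℝ) ≤
          ENNReal.ofReal D₀ := by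
  set K' : ℝ := max K 0 with hK'
  have hK'0 : 0 ≤ K' := le_max_right _ _
  set L₀ : ℝ := c₀ * (cS * K') with hL₀
  have hL₀0 : 0 ≤ L₀ := by positivity
  set V : ℝ := (volume (ball (0 : EuclideanSpace ℝ (Fin 3)) 1)).toReal with hV
  refine ⟨4 * (4 * ((2 : ℝ) ^ (1 / 2 : ℝ) * ((4 * c₀ * C ^ 2 * K') ^ (3 / 4 : ℝ) * V ^ (1 / 4 : ℝ)))) +
      4 * ((2 : ℝ) ^ (1 / 2 : ℝ) * (L₀ ^ (3 / 2 : ℝ) * V)), fun w hw hKw T hT => ?_⟩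
  obtain ⟨p, hcl, hNFw⟩ := hNF w hw
  -- the ledger with the nonnegative constant `K'`
  have hKw' : ∀ t < 0, ∀ (x₀ : EuclideanSpace ℝ (Fin 3)) (R : ℝ), 0 < R →
      ∫ x in ball x₀ R, ‖w t x‖ ^ 2 ≤ K' * R := fun t ht x₀ R hR =>
    (hKw t ht x₀ R hR).trans (mul_le_mul_of_nonneg_right (le_max_left _ _) hR.le)
  -- the far gradients are bounded by `L₀` (far-shell sum of the unit-ball ledger)
  have hNF' : ∀ τ ∈ Ioo (-3 : ℝ) 0, ∃ (c : ℝ) (p₁ p₂ : EuclideanSpace ℝ (Fin 3) → ℝ),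
      (∀ x ∈ ball (0 : EuclideanSpace ℝ (Fin 3)) 2, p τ x = c + p₁ x + p₂ x) ∧ MemLp p₁ 2 volume ∧
      ∫ x, p₁ x ^ 2 ≤ c₀ * (C ^ 2 / (-τ)) * ∫ x in ball (0 : EuclideanSpace ℝ (Fin 3)) 4, ‖w τ x‖ ^ 2 ∧
      ∀ x ∈ ball (0 : EuclideanSpace ℝ (Fin 3)) 2, DifferentiableAt ℝ p₂ x ∧ ‖fderiv ℝ p₂ x‖ ≤ L₀ := by
    intro τ hτ
    obtain ⟨c, p₁, p₂, hdec, hmem, hnear, hfar⟩ := hNFw τ hτ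
    have hτ0 : τ < 0 := hτ.2
    -- the far-shell sum for `g = ‖w(τ, ·)‖²`
    set g : EuclideanSpace ℝ (Fin 3) → ℝ := fun y => ‖w τ y‖ ^ 2 with hg
    have hgc : Continuous g := (hw.continuous_slice hτ0).norm.pow 2
    have hg0 : ∀ x, 0 ≤ g x := fun x => sq_nonneg _
    have hgM : ∃ M : ℝ, ∀ x, g x ≤ M := ⟨(C / Real.sqrt (-τ)) ^ 2, fun x =>
      pow_le_pow_left₀ (norm_nonneg _) (hw.norm_le hτ0 x) 2⟩
    have hgB : ∀ z : EuclideanSpace ℝ (Fin 3), ∫ x in ball z 1, g x ≤ K' := fun z => by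
      have := hKw' τ hτ0 z 1 one_pos
      rwa [mul_one] at this
    obtain ⟨-, hS⟩ := hShell g hgc hg0 hgM K' 0 hgB
    refine ⟨c, p₁, p₂, hdec, hmem, hnear, fun x hx => ⟨(hfar x hx).1, (hfar x hx).2.trans ?_⟩⟩
    rw [hL₀]
    exact mul_le_mul_of_nonneg_left hS hc₀
  refine ⟨fun s y => p (s - T) y - ⨍ y' in ball (0 : EuclideanSpace ℝ (Fin 3)) 1, p (s - T) y',
    inBall_shift_subMean hT.1 hT.2 hcl, ?_⟩
  exact shifted_pressure_lintegral_le hc₀ hK'0 hL₀0 hKw' hcl hNF' hT.1 hT.2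

end Summit.NavierStokesRegularity.NavierStokesRegularity.Theorems.AxisymEndLiouvilleOfFarPastLedger

end
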